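import Literature.MathematicalPhysics.QuantumFieldTheory.Balaban1983to89.Node00.WilsonActionSecondVariationCurve
import Literature.MathematicalPhysics.QuantumFieldTheory.Balaban1983to89.Node00.WilsonActionSecondVariationPlaqSmall
import Literature.MathematicalPhysics.QuantumFieldTheory.Balaban1983to89.Node00.AveragingSmooth
import Summits.QuantumFields.YangMills.Theorems.FluctuationComparisonRegPrIntLS2BetaFlatFibreTangent
import Summits.QuantumFields.YangMills.Theorems.FluctuationComparisonRegPrIntLS2BetaPivotResolveSmooth
import HarnessLib

/-!
# S2β · HESS∘ AT THE FLAT DATUM — the second variation of the Wilson action along an ARBITRARY C² curve through `1`,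
# and HESS∘(`V ≡ 1, U₀ ≡ 1`) from the chart's transversality alone

Cell `ym3-torus` (YM ladder rung R3 = continuum `SU(2)` Yang–Mills on the three-torus at fixed lattice data — a RUNG: NOT d = 4, NOT infinite volume,
NOT a mass gap, NOT Clay).  Width seat `ym3-torus-px16` (gen 17), brick 2 of the «FLAT INHABITANT of the (T)-chain» pen (★★OWNER g40 №238, px21 g18 GO
22:49Z).  Crux `stmt-QuantumFields-20520` (`…Theses.UnitScaleTilt.FluctuationComparisonRegPrIntL`), LINE S2β; `--kind proof --supports stmt-QuantumFields-20520
--as helper`: count-neutral, DEFINITION-FREE (0 `def`, 0 `instance`, 0 `notation`, 0 `sorry`, default heartbeats).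

WHY.  The (T)-chain (✓px21 g18 (T1)…(T2e), (T3) `…S2BetaTubeGrowthOfHessianPosDock`) reduces TUBE♭(V,U₀) to two analytic letters, HESS∘
(`∀ y ≠ 0, 0 < D²(A ∘ Φ(V,·) ∘ σ)(0) y y`, print's second-order sufficient condition [Balaban1985Variational] (142)) and ISOL∘(δ).  Brick 1
(✓`…S2BetaFlatFibreTangent`) proved HESS∘ at the flat datum modulo two rows: the chart's transversality `hT` and a second-order chain rule `hCR` writing
`D²(A∘Ψ)(0)(y,y)` as a positive multiple of the curl energy of the velocity.  THIS FILE DISCHARGES `hCR` for an ARBITRARY `C²` chart through `1` — no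
exponential chart, no norm choice — and hence proves HESS∘ at `(V ≡ 1, U₀ ≡ 1)` from `hT` ALONE (plus the two bookkeeping rows «`C²`» and «valued in the
flat fibre», both ✓ for the chart of record by (T2e) and the window-chart clauses).

WHAT (Hilbert–Schmidt currency `Re Tr(C⋆C)`; `SU N = Matrix.specialUnitaryGroup (Fin N) ℂ`, any `N ≥ 1`; lattice `P : Params`, level `j`).
* §1 unitary curves through `1`: velocity/acceleration identities `V γ⋆ + γ V⋆ = 0`, `V⋆ = −V` at `γ = 1`, `W + W⋆ = −2 V V⋆`, `Re Tr W = Re Tr V²`.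
* §2 the plaquette bracket at `1`: NODE 00's chart-free integrand ([Balaban1985BackgroundPropagators] (3.2)) collapses to `−Re Tr(C⋆ C)`, `C = V₁+V₂−V₃−V₄`.
* §3 ★★★`deriv_deriv_wilsonAction4_along_one`: for ANY curve `γ` of gauge fields, differentiable near `t₀` with velocities `V_t` differentiable at `t₀`, and
  `γ_{t₀} = 1`: `(d∕dt)² A(γ_t)|_{t₀} = (1∕N)·Σ_p Re Tr(C_p⋆ C_p)`, `C_p` = plaquette curl of `V_{t₀}` — the acceleration drops out BY CRITICALITY of `1`
  (lit ✓`Node00.hasDerivAt_deriv_wilsonAction4_along` + §1–§2).  [Balaban1985BackgroundPropagators (3.7), (3.10) pp.391–392]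
* §4 ★★★`iteratedDeriv_two_wilsonAction4_line_one`: the same along the lines `t ↦ Ψ(t•y)` of a chart `Ψ` with `coeField ∘ Ψ` `C²` at `0`, `Ψ 0 = 1`,
  velocity `fderiv (coeField ∘ Ψ) 0 y`.
* §5 ★★★`iteratedDeriv_two_pos_flat_of_transversal` (line form = the `hline` row of ✓(T1) `growthRow_of_line_pos`) and ★★★`hessPos_flat_of_transversal`
  (Fréchet form = (T3)'s `hH` text with `Ψ y := c.Φ (1, σ y)`): HESS∘ at the flat datum ⟸ {`C²`, flat-fibre-valued near `0`, `hT`}; each term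
  `Re Tr(C⋆C) ≥ 0` by lit ✓`Node00.matrix_re_trace_star_mul_self_nonneg`; the kernel step is brick 1's ✓`iterLin_fderiv_eq_zero_of_descendTo_eq_one`
  + ✓`N12FlatFibreNullSpace.exists_centreGauge_of_plaq_eq_zero_of_iterLin_eq_zero`.

HONEST.  Calculus at ONE point of ONE fibre (the flat one); `hT` (first-order transversality of the chart of record to the centre-vanishing pure gauges) is NOT
proved here; HESS∘ at a general datum ([Balaban1985BackgroundPropagators] Thm 3.11, K-uniform), ISOL∘(δ), TUBE-REG∘, GAP♯∘, EXW∘, S2β and crux 20520 are NOT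
proved; rung R3 = `YM3TorusSU2` as filed — SU(2) YM₃ on T³; the Yang–Mills mass gap is NOT proved.
[cite: Balaban1985BackgroundPropagators, (3.2) p.390, (3.7) p.391, (3.10)-(3.11) p.392; Balaban1985Variational, (142) p.299, Sect. E p.300;
Balaban1989LargeFieldII, (1.9) p.358]
-/

noncomputable section

open Filter Topology
open scoped Matrix.Norms.L2Operator
open Literature.MathematicalPhysics.QuantumFieldTheory.Balaban1983to89
open Literature.MathematicalPhysics.QuantumFieldTheory.Balaban1983to89.Node00
open T3ContinuumYM3Torus (T3Family)
open T3TiltDescent (descendTo)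
open ExpMeanLog (expMeanLogSU)
open BlockAveragingEMLLinearised (linAvg)
open B15DeterminingSets (embIter)
open Summit.QuantumFields.YangMills.BalabanUVNodes.N12FlatFibreNullSpace (exists_centreGauge_of_plaq_eq_zero_of_iterLin_eq_zero)
open Summit.QuantumFields.YangMills.Theorems.FluctuationComparisonRegPrIntLS2BetaFlatFibreTangent (iterLin_fderiv_eq_zero_of_descendTo_eq_one)
open Summit.QuantumFields.YangMills.Theorems.FluctuationComparisonRegPrIntLS2BetaPivotResolveSmooth (contDiffAt_wilsonAction4_of_coeField)

namespace Summit.QuantumFields.YangMills.Theorems.FluctuationComparisonRegPrIntLS2BetaFlatSecondVariationAlongCurve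

/-! ## §1 Unitary curves through `1`: the velocity is skew, the acceleration's Hermitian part is `−V V⋆` -/

section Unitary

variable {N : ℕ}

/-- Along a differentiable curve of special unitary matrices, `V_t·γ_t⋆ + γ_t·V_t⋆ = 0` at every parameter where the velocity exists
(differentiate `γγ⋆ = 1`). [folklore] -/
theorem vel_mul_star_add_eq_zero {u : ℝ → SU N} {V : Matrix (Fin N) (Fin N) ℂ} {t : ℝ}
    (hu : HasDerivAt (fun s => ((u s : SU N) : Matrix (Fin N) (Fin N) ℂ)) V t) :
    V * star ((u t : SU N) : Matrix (Fin N) (Fin N) ℂ) + ((u t : SU N) : Matrix (Fin N) (Fin N) ℂ) * star V = 0 := by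
  have hconst : (fun s => ((u s : SU N) : Matrix (Fin N) (Fin N) ℂ) * star ((u s : SU N) : Matrix (Fin N) (Fin N) ℂ)) = fun _ => 1 := by
    funext s
    exact Matrix.mem_unitaryGroup_iff.1 (Matrix.mem_specialUnitaryGroup_iff.1 (u s).2).1
  have hd : HasDerivAt (fun s => ((u s : SU N) : Matrix (Fin N) (Fin N) ℂ) * star ((u s : SU N) : Matrix (Fin N) (Fin N) ℂ))
      (V * star ((u t : SU N) : Matrix (Fin N) (Fin N) ℂ) + ((u t : SU N) : Matrix (Fin N) (Fin N) ℂ) * star V) t :=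
    hu.mul hu.star
  rw [hconst] at hd
  exact ((hasDerivAt_const t (1 : Matrix (Fin N) (Fin N) ℂ)).unique hd).symm

/-- At a parameter where the curve passes through `1`, the velocity is skew-Hermitian: `V⋆ = −V`. [folklore] -/
theorem star_vel_eq_neg {u : ℝ → SU N} {V : Matrix (Fin N) (Fin N) ℂ} {t : ℝ}
    (hu : HasDerivAt (fun s => ((u s : SU N) : Matrix (Fin N) (Fin N) ℂ)) V t) (h1 : u t = 1) : star V = -V := by
  have h := vel_mul_star_add_eq_zero hu
  rw [h1] at h
  simp only [OneMemClass.coe_one, star_one, mul_one, one_mul] at h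
  exact eq_neg_of_add_eq_zero_right h

/-- The SECOND-ORDER unitarity identity at a parameter where the curve passes through `1`: `W + W⋆ = −2·V·V⋆` (differentiate `V_s u_s⋆ + u_s V_s⋆ ≡ 0`). [folklore] -/
theorem acc_add_star_acc_eq {u : ℝ → SU N} {V : ℝ → Matrix (Fin N) (Fin N) ℂ} {W : Matrix (Fin N) (Fin N) ℂ} {t₀ : ℝ}
    (hu : ∀ᶠ t in 𝓝 t₀, HasDerivAt (fun s => ((u s : SU N) : Matrix (Fin N) (Fin N) ℂ)) (V t) t)
    (hV : HasDerivAt V W t₀) (h1 : u t₀ = 1) :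
    W + star W = -(2 • (V t₀ * star (V t₀))) := by
  -- the first-order identity holds identically near `t₀`
  have hzero : (fun t => V t * star ((u t : SU N) : Matrix (Fin N) (Fin N) ℂ) + ((u t : SU N) : Matrix (Fin N) (Fin N) ℂ) * star (V t)) =ᶠ[𝓝 t₀]
      fun _ => (0 : Matrix (Fin N) (Fin N) ℂ) :=
    hu.mono fun t ht => vel_mul_star_add_eq_zero ht
  have hu0 : HasDerivAt (fun s => ((u s : SU N) : Matrix (Fin N) (Fin N) ℂ)) (V t₀) t₀ := hu.self_of_nhds
  -- differentiate it at `t₀`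
  have hd : HasDerivAt (fun t => V t * star ((u t : SU N) : Matrix (Fin N) (Fin N) ℂ) + ((u t : SU N) : Matrix (Fin N) (Fin N) ℂ) * star (V t))
      ((W * star ((u t₀ : SU N) : Matrix (Fin N) (Fin N) ℂ) + V t₀ * star (V t₀)) +
        (V t₀ * star (V t₀) + ((u t₀ : SU N) : Matrix (Fin N) (Fin N) ℂ) * star W)) t₀ :=
    (hV.mul hu0.star).add (hu0.mul hV.star)
  have h0 : (W * star ((u t₀ : SU N) : Matrix (Fin N) (Fin N) ℂ) + V t₀ * star (V t₀)) +
      (V t₀ * star (V t₀) + ((u t₀ : SU N) : Matrix (Fin N) (Fin N) ℂ) * star W) = 0 :=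
    (hd.congr_of_eventuallyEq hzero.symm).unique (hasDerivAt_const t₀ (0 : Matrix (Fin N) (Fin N) ℂ))
  rw [h1] at h0
  simp only [OneMemClass.coe_one, star_one, mul_one, one_mul] at h0
  -- `W + VV⋆ + (VV⋆ + W⋆) = 0`
  rw [two_smul]
  have : W + star W = -(V t₀ * star (V t₀) + V t₀ * star (V t₀)) := by
    rw [eq_neg_iff_add_eq_zero, ← h0]; abel
  exact this

/-- Consequence at `1`: the real trace of the acceleration is `Re Tr(V²)` (`Re Tr W = ½Re Tr(W + W⋆) = −Re Tr(VV⋆) = Re Tr(V²)`). [folklore] -/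
theorem re_trace_acc_eq {V W : Matrix (Fin N) (Fin N) ℂ} (hW : W + star W = -(2 • (V * star V))) (hV : star V = -V) :
    (Matrix.trace W).re = (Matrix.trace (V * V)).re := by
  rw [hV, Matrix.mul_neg, smul_neg, neg_neg, two_smul] at hW
  have h := congrArg (fun M : Matrix (Fin N) (Fin N) ℂ => (Matrix.trace M).re) hW
  have hs : (Matrix.trace (star W)).re = (Matrix.trace W).re := by
    rw [Matrix.star_eq_conjTranspose, Matrix.trace_conjTranspose, Complex.star_def, Complex.conj_re]
  simp only [Matrix.trace_add, Complex.add_re, hs] at h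
  linarith

end Unitary

/-! ## §2 The plaquette algebra at the flat configuration -/

section Plaquette

variable {N : ℕ}

/-- THE FLAT PLAQUETTE IDENTITY: with skew velocities `V_k⋆ = −V_k` and accelerations of real trace `Re Tr(V_k²)`, minus the real trace of NODE 00's second-variation
bracket at `U ≡ 1` is the Hilbert–Schmidt square of the plaquette curl `C = V₁ + V₂ − V₃ − V₄`. [cite: Balaban1985BackgroundPropagators, (3.2) p.390, (3.10) p.392] -/
theorem neg_re_trace_bracket_one_eq (V₁ V₂ V₃ V₄ W₁ W₂ W₃ W₄ : Matrix (Fin N) (Fin N) ℂ)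
    (hV₁ : star V₁ = -V₁) (hV₂ : star V₂ = -V₂) (hV₃ : star V₃ = -V₃) (hV₄ : star V₄ = -V₄)
    (hW₁ : (Matrix.trace W₁).re = (Matrix.trace (V₁ * V₁)).re) (hW₂ : (Matrix.trace W₂).re = (Matrix.trace (V₂ * V₂)).re)
    (hW₃ : (Matrix.trace W₃).re = (Matrix.trace (V₃ * V₃)).re) (hW₄ : (Matrix.trace W₄).re = (Matrix.trace (V₄ * V₄)).re) :
    -(Matrix.trace (W₁ + W₂ + star W₃ + star W₄ +
        2 • (V₁ * V₂ + V₁ * star V₃ + V₁ * star V₄ + V₂ * star V₃ + V₂ * star V₄ + star V₃ * star V₄))).re =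
      (Matrix.trace (star (V₁ + V₂ - V₃ - V₄) * (V₁ + V₂ - V₃ - V₄))).re := by
  -- real traces of starred accelerations
  have hs : ∀ W : Matrix (Fin N) (Fin N) ℂ, (Matrix.trace (star W)).re = (Matrix.trace W).re := fun W => by
    rw [Matrix.star_eq_conjTranspose, Matrix.trace_conjTranspose, Complex.star_def, Complex.conj_re]
  -- symmetric cross traces
  have hc : ∀ A B : Matrix (Fin N) (Fin N) ℂ, (Matrix.trace (A * B)).re = (Matrix.trace (B * A)).re := fun A B => by
    rw [Matrix.trace_mul_comm]
  simp only [two_smul, star_add, star_sub, hV₁, hV₂, hV₃, hV₄, neg_neg, Matrix.trace_add, Matrix.trace_sub, Matrix.trace_neg,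
    Matrix.mul_add, Matrix.add_mul, Matrix.mul_sub, Matrix.mul_neg, Matrix.neg_mul, sub_neg_eq_add, neg_neg,
    Complex.add_re, Complex.sub_re, Complex.neg_re, hs, hW₁, hW₂, hW₃, hW₄]
  rw [hc V₂ V₁, hc V₃ V₁, hc V₄ V₁, hc V₃ V₂, hc V₄ V₂, hc V₄ V₃]
  ring

end Plaquette

/-! ## §3 The flat second variation along an arbitrary C² curve -/

section Along

variable {P : Params} {j : ℕ} {N : ℕ} [NeZero N]

/-- ★★★ **THE FLAT SECOND VARIATION OF THE WILSON ACTION ALONG AN ARBITRARY C² CURVE THROUGH `1` IS THE HILBERT–SCHMIDT CURL ENERGY OF ITS VELOCITY**: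
for `γ` with bondwise matrix velocities `V t` near `t₀`, accelerations `W` at `t₀` and `γ t₀ = 1`,
`d²∕dt² A(γ_t)|_{t₀} = (1∕N)·Σ_p Re Tr(C_p⋆ C_p)`, `C_p = V₁ + V₂ − V₃ − V₄` the plaquette curl of the velocity — NODE 00's chart-free formula
✓`hasDerivAt_deriv_wilsonAction4_along` read at the flat configuration through the unitarity identities of §1 (the acceleration drops out: its real trace is
`Re Tr(V²)`, which completes the square).  The `expChart` ray `t ↦ e^{tX}` is the special case ✓`deriv_deriv_wilsonAction4_expChart_one`.
[cite: Balaban1985BackgroundPropagators, (3.7) p.391, (3.10) p.392; Balaban1989LargeFieldII, p.357] -/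
theorem deriv_deriv_wilsonAction4_along_one {γ : ℝ → GaugeField P j (SU N)} {V : ℝ → PBond P j → Matrix (Fin N) (Fin N) ℂ}
    {W : PBond P j → Matrix (Fin N) (Fin N) ℂ} {t₀ : ℝ}
    (hγ : ∀ᶠ t in 𝓝 t₀, ∀ b, HasDerivAt (fun s => ((γ s b : SU N) : Matrix (Fin N) (Fin N) ℂ)) (V t b) t)
    (hV : ∀ b, HasDerivAt (fun s => V s b) (W b) t₀) (h1 : γ t₀ = 1) :
    deriv (deriv fun s => wilsonAction4 (γ s)) t₀ =
      (∑ p : Plaq P j, (Matrix.trace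
        (star (V t₀ ⟨p.src, p.μ⟩ + V t₀ ⟨p.src.shift p.μ, p.ν⟩ - V t₀ ⟨p.src.shift p.ν, p.μ⟩ - V t₀ ⟨p.src, p.ν⟩) *
          (V t₀ ⟨p.src, p.μ⟩ + V t₀ ⟨p.src.shift p.μ, p.ν⟩ - V t₀ ⟨p.src.shift p.ν, p.μ⟩ - V t₀ ⟨p.src, p.ν⟩))).re) / (Fintype.card (Fin N) : ℝ) := by
  have hformula := (hasDerivAt_deriv_wilsonAction4_along hγ hV).deriv
  rw [hformula]
  -- bondwise unitarity letters at `t₀`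
  have hu : ∀ b, ∀ᶠ t in 𝓝 t₀, HasDerivAt (fun s => ((γ s b : SU N) : Matrix (Fin N) (Fin N) ℂ)) (V t b) t :=
    fun b => hγ.mono fun t ht => ht b
  have h1b : ∀ b, γ t₀ b = 1 := fun b => by rw [h1]; rfl
  have hcoe : ∀ b, ((γ t₀ b : SU N) : Matrix (Fin N) (Fin N) ℂ) = 1 := fun b => by rw [h1b]; rfl
  have hsk : ∀ b, star (V t₀ b) = -V t₀ b := fun b =>
    star_vel_eq_neg (u := fun s => γ s b) (V := V t₀ b) (t := t₀) (hu b).self_of_nhds (h1b b)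
  have hac : ∀ b, (Matrix.trace (W b)).re = (Matrix.trace (V t₀ b * V t₀ b)).re := fun b =>
    re_trace_acc_eq (acc_add_star_acc_eq (u := fun s => γ s b) (V := fun s => V s b) (W := W b) (t₀ := t₀) (hu b) (hV b) (h1b b)) (hsk b)
  simp only [hcoe, one_mul, mul_one, star_one]
  rw [← Finset.sum_neg_distrib]
  congr 1
  refine Finset.sum_congr rfl fun p _ => ?_
  exact neg_re_trace_bracket_one_eq (V t₀ ⟨p.src, p.μ⟩) (V t₀ ⟨p.src.shift p.μ, p.ν⟩) (V t₀ ⟨p.src.shift p.ν, p.μ⟩) (V t₀ ⟨p.src, p.ν⟩)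
    (W ⟨p.src, p.μ⟩) (W ⟨p.src.shift p.μ, p.ν⟩) (W ⟨p.src.shift p.ν, p.μ⟩) (W ⟨p.src, p.ν⟩)
    (hsk _) (hsk _) (hsk _) (hsk _) (hac _) (hac _) (hac _) (hac _)

end Along

/-! ## §4 Along a line of a C² chart through `1` -/

section Chart

variable {P : Params} {j : ℕ} {N : ℕ} [NeZero N]
variable {Y : Type*} [NormedAddCommGroup Y] [NormedSpace ℝ Y]

/-- ★★★ **THE SECOND-ORDER CHAIN RULE AT THE FLAT CRITICAL POINT, FOR AN ARBITRARY C² CHART**: if `y ↦ coeField (Ψ y)` is `C²` at `0` and `Ψ 0 = 1`, then along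
every line `iteratedDeriv 2 (t ↦ A(Ψ(t•y))) 0 = (1∕N)·Σ_p Re Tr(C_p⋆ C_p)` with `C_p` the plaquette curl of the velocity `Ψ′y = fderiv (coeField ∘ Ψ) 0 y` — the `hCR`
letter of ✓`…S2BetaFlatFibreTangent.hessPos_flat_of_transversal_of_chainRule` in Hilbert–Schmidt currency, discharged.
[cite: Balaban1985BackgroundPropagators, (3.7) p.391, (3.10) p.392; Balaban1985Variational, (142) p.299] -/
theorem iteratedDeriv_two_wilsonAction4_line_one {Ψ : Y → GaugeField P j (SU N)}
    (hΨ : ContDiffAt ℝ 2 (fun y => coeField (Ψ y)) 0) (hΨ0 : Ψ 0 = 1) (y : Y) :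
    iteratedDeriv 2 (fun t : ℝ => wilsonAction4 (Ψ (t • y))) 0 =
      (∑ p : Plaq P j, (Matrix.trace
        (star (fderiv ℝ (fun y => coeField (Ψ y)) 0 y ⟨p.src, p.μ⟩ + fderiv ℝ (fun y => coeField (Ψ y)) 0 y ⟨p.src.shift p.μ, p.ν⟩
            - fderiv ℝ (fun y => coeField (Ψ y)) 0 y ⟨p.src.shift p.ν, p.μ⟩ - fderiv ℝ (fun y => coeField (Ψ y)) 0 y ⟨p.src, p.ν⟩) *
          (fderiv ℝ (fun y => coeField (Ψ y)) 0 y ⟨p.src, p.μ⟩ + fderiv ℝ (fun y => coeField (Ψ y)) 0 y ⟨p.src.shift p.μ, p.ν⟩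
            - fderiv ℝ (fun y => coeField (Ψ y)) 0 y ⟨p.src.shift p.ν, p.μ⟩ - fderiv ℝ (fun y => coeField (Ψ y)) 0 y ⟨p.src, p.ν⟩))).re) /
        (Fintype.card (Fin N) : ℝ) := by
  set f : Y → PBond P j → Matrix (Fin N) (Fin N) ℂ := fun y => coeField (Ψ y) with hf
  -- the line and its derivative
  have hline : ∀ t : ℝ, HasDerivAt (fun s : ℝ => s • y) y t := fun t => by
    simpa using (hasDerivAt_id t).smul_const y
  have hline0 : Tendsto (fun t : ℝ => t • y) (𝓝 0) (𝓝 0) := by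
    simpa using (hline 0).continuousAt.tendsto
  -- `f` is differentiable near `0`, and `fderiv f` is differentiable at `0`
  have hdiff : ∀ᶠ z in 𝓝 (0 : Y), DifferentiableAt ℝ f z :=
    (hΨ.eventually (by simp)).mono fun z hz => hz.differentiableAt (by simp)
  have hfd : DifferentiableAt ℝ (fderiv ℝ f) 0 :=
    (hΨ.fderiv_right (m := 1) (by norm_num)).differentiableAt (by norm_num)
  -- velocities along the line
  have hV : ∀ᶠ t in 𝓝 (0 : ℝ), ∀ b, HasDerivAt (fun s => ((Ψ (s • y) b : SU N) : Matrix (Fin N) (Fin N) ℂ)) (fderiv ℝ f (t • y) y b) t := by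
    filter_upwards [hline0.eventually hdiff] with t ht
    intro b
    have ht' : HasFDerivAt f (fderiv ℝ f (t • y)) (t • y) := ht.hasFDerivAt
    have h1 : HasDerivAt (f ∘ fun s : ℝ => s • y) (fderiv ℝ f (t • y) y) t := ht'.comp_hasDerivAt t (hline t)
    exact (hasDerivAt_pi.1 h1) b
  -- accelerations at `0`
  have hW : ∀ b, HasDerivAt (fun s : ℝ => fderiv ℝ f (s • y) y b) (fderiv ℝ (fderiv ℝ f) 0 y y b) 0 := by
    intro b
    have hfd' : HasFDerivAt (fderiv ℝ f) (fderiv ℝ (fderiv ℝ f) 0) 0 := hfd.hasFDerivAt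
    have hev : HasFDerivAt (fun z : Y => fderiv ℝ f z y)
        ((ContinuousLinearMap.apply ℝ (PBond P j → Matrix (Fin N) (Fin N) ℂ) y).comp (fderiv ℝ (fderiv ℝ f) 0)) 0 :=
      (ContinuousLinearMap.apply ℝ (PBond P j → Matrix (Fin N) (Fin N) ℂ) y).hasFDerivAt.comp 0 hfd'
    have h3 : HasDerivAt ((fun z : Y => fderiv ℝ f z y) ∘ fun s : ℝ => s • y)
        (((ContinuousLinearMap.apply ℝ (PBond P j → Matrix (Fin N) (Fin N) ℂ) y).comp (fderiv ℝ (fderiv ℝ f) 0)) y) 0 :=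
      hev.comp_hasDerivAt_of_eq (0 : ℝ) (hline 0) (zero_smul ℝ y).symm
    exact (hasDerivAt_pi.1 h3) b
  have h1 : Ψ ((0 : ℝ) • y) = 1 := by rw [zero_smul]; exact hΨ0
  have key := deriv_deriv_wilsonAction4_along_one (γ := fun s => Ψ (s • y)) (V := fun t b => fderiv ℝ f (t • y) y b)
    (W := fun b => fderiv ℝ (fderiv ℝ f) 0 y y b) (t₀ := 0) hV hW h1
  simp only [zero_smul] at key
  rw [iteratedDeriv_succ, iteratedDeriv_one]
  exact key

end Chart

/-! ## §5 HESS∘ at the flat datum from the chart's transversality alone -/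

section Flat

variable {N : ℕ} [NeZero N]
variable (F : T3Family) {n K : ℕ} (h : n ≤ K)
variable {Y : Type*} [NormedAddCommGroup Y] [NormedSpace ℝ Y]

omit [NeZero N] in
/-- `Re Tr(C⋆ C) = 0` forces `C = 0`. [folklore] -/
theorem eq_zero_of_re_trace_star_mul_self_eq_zero (C : Matrix (Fin N) (Fin N) ℂ) (hC : (Matrix.trace (star C * C)).re = 0) : C = 0 := by
  open scoped ComplexOrder in
  have h := (Matrix.posSemidef_conjTranspose_mul_self C).trace_nonneg
  obtain ⟨_, him⟩ := Complex.nonneg_iff.1 h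
  rw [Matrix.star_eq_conjTranspose] at hC
  open scoped ComplexOrder in
  exact Matrix.trace_conjTranspose_mul_self_eq_zero_iff.1 (Complex.ext (by simpa using hC) (by simpa using him.symm))

/-- The second derivative along a line through `0` of a real function `C²` at `0` is the diagonal second Fréchet derivative. [folklore] -/
theorem iteratedDeriv_two_line_eq_fderiv_fderiv_zero {g : Y → ℝ} (hg : ContDiffAt ℝ 2 g 0) (y : Y) :
    iteratedDeriv 2 (fun t : ℝ => g (t • y)) 0 = fderiv ℝ (fderiv ℝ g) 0 y y := by
  have hline : ∀ t : ℝ, HasDerivAt (fun s : ℝ => s • y) y t := fun t => by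
    simpa using (hasDerivAt_id t).smul_const y
  have hline0 : Tendsto (fun t : ℝ => t • y) (𝓝 0) (𝓝 0) := by
    simpa using (hline 0).continuousAt.tendsto
  have hdiff : ∀ᶠ z in 𝓝 (0 : Y), DifferentiableAt ℝ g z :=
    (hg.eventually (by simp)).mono fun z hz => hz.differentiableAt (by simp)
  have hfd : DifferentiableAt ℝ (fderiv ℝ g) 0 :=
    (hg.fderiv_right (m := 1) (by norm_num)).differentiableAt (by norm_num)
  have hD : ∀ᶠ t in 𝓝 (0 : ℝ), HasDerivAt (fun s : ℝ => g (s • y)) (fderiv ℝ g (t • y) y) t := by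
    filter_upwards [hline0.eventually hdiff] with t ht
    exact ht.hasFDerivAt.comp_hasDerivAt t (hline t)
  have hderiv : deriv (fun s : ℝ => g (s • y)) =ᶠ[𝓝 0] fun t => fderiv ℝ g (t • y) y := hD.mono fun t ht => ht.deriv
  rw [iteratedDeriv_succ, iteratedDeriv_one, hderiv.deriv_eq]
  have hfd' : HasFDerivAt (fderiv ℝ g) (fderiv ℝ (fderiv ℝ g) 0) 0 := hfd.hasFDerivAt
  have hev : HasFDerivAt (fun z : Y => fderiv ℝ g z y) ((ContinuousLinearMap.apply ℝ ℝ y).comp (fderiv ℝ (fderiv ℝ g) 0)) 0 :=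
    (ContinuousLinearMap.apply ℝ ℝ y).hasFDerivAt.comp 0 hfd'
  have h3 : HasDerivAt ((fun z : Y => fderiv ℝ g z y) ∘ fun s : ℝ => s • y)
      (((ContinuousLinearMap.apply ℝ ℝ y).comp (fderiv ℝ (fderiv ℝ g) 0)) y) 0 :=
    hev.comp_hasDerivAt_of_eq (0 : ℝ) (hline 0) (zero_smul ℝ y).symm
  exact h3.deriv

/-- ★★★ **HESS∘ AT THE FLAT DATUM `(V ≡ 1, U₀ ≡ 1)` FROM TRANSVERSALITY ALONE (line form).**  Let `Ψ : Y → fields` be a chart through `1` with `coeField ∘ Ψ`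
of class `C²` at `0`, valued in the flat fibre (`D_{n,K}(Ψ y) = 1` near `0`), and transversal to the centre-vanishing pure gauges at first order (`hT`).  Then for every
`y ≠ 0` the Wilson action is strictly convex along the line `t ↦ Ψ(t•y)` at `t = 0`: `0 < (d²∕dt²) A(Ψ(t•y))|₀`.  Proof: §4 writes the second derivative as
`(1∕N)·Σ_p Re Tr(C_p⋆ C_p)` (curl energy of the velocity `Ψ′y`); if it vanished, every plaquette curl of `Ψ′y` would vanish, and since
`Ψ′y ∈ ker Q^{(K−n)}` (✓`…S2BetaFlatFibreTangent.iterLin_fderiv_eq_zero_of_descendTo_eq_one`) the flat null-space theorem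
(✓`N12FlatFibreNullSpace.exists_centreGauge_of_plaq_eq_zero_of_iterLin_eq_zero`) makes `Ψ′y` a centre-vanishing gradient, excluded by `hT`.  This is the
`hline` row of ✓`…S2BetaGrowthOfHessianPos.growthRow_of_line_pos` at the flat datum — the (T)-chain's HESS∘ letter there, with NO chain-rule or norm hypothesis left.
[cite: Balaban1985Variational, (142) p.299, Sect. E p.300; Balaban1985BackgroundPropagators, (3.7) p.391, (3.10)-(3.11) p.392; Balaban1989LargeFieldII, (1.9) p.358] -/
theorem iteratedDeriv_two_pos_flat_of_transversal
    (Q : (i : ℕ) → (PBond (F.P K) 0 → Matrix (Fin N) (Fin N) ℂ) → PBond (F.P K) i → Matrix (Fin N) (Fin N) ℂ)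
    (hQ0 : ∀ Y, Q 0 Y = Y)
    (hQs : ∀ (i : ℕ) (Y : PBond (F.P K) 0 → Matrix (Fin N) (Fin N) ℂ) (c : PBond (F.P K) (i + 1)), Q (i + 1) Y c = linAvg (Q i Y) c)
    {Ψ : Y → GaugeField (F.P K) 0 (SU N)}
    (hΨ : ContDiffAt ℝ 2 (fun y => coeField (Ψ y)) 0) (hΨ0 : Ψ 0 = 1)
    (hfib : ∀ᶠ y in 𝓝 (0 : Y), descendTo F (expMeanLogSU (n := Fin N)) n K h (Ψ y) = 1)
    (hT : ∀ (φ : Site (F.P K) 0 → Matrix (Fin N) (Fin N) ℂ), (∀ x : Site (F.P K) (K - n), φ (embIter (K - n) x) = 0) →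
      ∀ y : Y, (∀ b : PBond (F.P K) 0, fderiv ℝ (fun y => coeField (Ψ y)) 0 y b = φ b.tgt - φ b.src) → y = 0) :
    ∀ y : Y, y ≠ 0 → 0 < iteratedDeriv 2 (fun t : ℝ => wilsonAction4 (Ψ (t • y))) 0 := by
  intro y hy
  rw [iteratedDeriv_two_wilsonAction4_line_one hΨ hΨ0 y]
  set Ψ' : Y →L[ℝ] (PBond (F.P K) 0 → Matrix (Fin N) (Fin N) ℂ) := fderiv ℝ (fun y => coeField (Ψ y)) 0 with hΨ'def
  have hN : (0 : ℝ) < (Fintype.card (Fin N) : ℝ) := by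
    rw [Fintype.card_fin]
    exact_mod_cast NeZero.pos N
  refine div_pos ?_ hN
  set C : Plaq (F.P K) 0 → Matrix (Fin N) (Fin N) ℂ :=
    fun p => Ψ' y ⟨p.src, p.μ⟩ + Ψ' y ⟨p.src.shift p.μ, p.ν⟩ - Ψ' y ⟨p.src.shift p.ν, p.μ⟩ - Ψ' y ⟨p.src, p.ν⟩ with hCdef
  change 0 < ∑ p : Plaq (F.P K) 0, (Matrix.trace (star (C p) * C p)).re
  -- if the curl energy vanished, the velocity would be a centre-vanishing gradient, excluded by transversality
  by_contra hle
  have hsum : ∑ p : Plaq (F.P K) 0, (Matrix.trace (star (C p) * C p)).re = 0 :=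
    le_antisymm (not_lt.1 hle) (Finset.sum_nonneg fun p _ => matrix_re_trace_star_mul_self_nonneg (C p))
  have hcurl : ∀ p : Plaq (F.P K) 0,
      Ψ' y ⟨p.src, p.μ⟩ + Ψ' y ⟨p.src.shift p.μ, p.ν⟩ - Ψ' y ⟨p.src.shift p.ν, p.μ⟩ - Ψ' y ⟨p.src, p.ν⟩ = 0 := fun p =>
    eq_zero_of_re_trace_star_mul_self_eq_zero (C p)
      ((Finset.sum_eq_zero_iff_of_nonneg fun p _ => matrix_re_trace_star_mul_self_nonneg (C p)).1 hsum p (Finset.mem_univ p))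
  have hΨd : HasFDerivAt (fun y => coeField (Ψ y)) Ψ' 0 := (hΨ.differentiableAt (by simp)).hasFDerivAt
  have hQ := iterLin_fderiv_eq_zero_of_descendTo_eq_one F h Q hQ0 hQs (Ψ := Ψ) (Ψ' := Ψ') hΨd hΨ0 hfib y
  obtain ⟨φ, hφ0, hφ⟩ := exists_centreGauge_of_plaq_eq_zero_of_iterLin_eq_zero Q hQ0 hQs (K - n) (Ψ' y) hcurl hQ
  exact hy (hT φ hφ0 y hφ)

/-- ★★★ **HESS∘ AT THE FLAT DATUM, FRÉCHET FORM** — literally the (T2c) letter `hH : ∀ y, y ≠ 0 → 0 < fderiv ℝ (fderiv ℝ (A ∘ Ψ)) 0 y y` at `(V ≡ 1, U₀ ≡ 1)`,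
from the same three chart hypotheses (C², flat fibre, transversal); the action's `C²` regularity comes from ✓`…S2BetaPivotResolveSmooth.contDiffAt_wilsonAction4_of_coeField`.
[cite: Balaban1985Variational, (142) p.299; Balaban1989LargeFieldII, (1.9) p.358] -/
theorem hessPos_flat_of_transversal
    (Q : (i : ℕ) → (PBond (F.P K) 0 → Matrix (Fin N) (Fin N) ℂ) → PBond (F.P K) i → Matrix (Fin N) (Fin N) ℂ)
    (hQ0 : ∀ Y, Q 0 Y = Y)
    (hQs : ∀ (i : ℕ) (Y : PBond (F.P K) 0 → Matrix (Fin N) (Fin N) ℂ) (c : PBond (F.P K) (i + 1)), Q (i + 1) Y c = linAvg (Q i Y) c)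
    {Ψ : Y → GaugeField (F.P K) 0 (SU N)}
    (hΨ : ContDiffAt ℝ 2 (fun y => coeField (Ψ y)) 0) (hΨ0 : Ψ 0 = 1)
    (hfib : ∀ᶠ y in 𝓝 (0 : Y), descendTo F (expMeanLogSU (n := Fin N)) n K h (Ψ y) = 1)
    (hT : ∀ (φ : Site (F.P K) 0 → Matrix (Fin N) (Fin N) ℂ), (∀ x : Site (F.P K) (K - n), φ (embIter (K - n) x) = 0) →
      ∀ y : Y, (∀ b : PBond (F.P K) 0, fderiv ℝ (fun y => coeField (Ψ y)) 0 y b = φ b.tgt - φ b.src) → y = 0) :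
    ∀ y : Y, y ≠ 0 → 0 < fderiv ℝ (fderiv ℝ (fun y => wilsonAction4 (Ψ y))) 0 y y := by
  intro y hy
  rw [← iteratedDeriv_two_line_eq_fderiv_fderiv_zero (contDiffAt_wilsonAction4_of_coeField hΨ) y]
  exact iteratedDeriv_two_pos_flat_of_transversal F h Q hQ0 hQs hΨ hΨ0 hfib hT y hy

end Flat

end Summit.QuantumFields.YangMills.Theorems.FluctuationComparisonRegPrIntLS2BetaFlatSecondVariationAlongCurve

end
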